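import Mathlib
import Literature.Computability.AlgebraicComplexity.NestFreeMatchingFifo
import Summits.ValiantsHypothesis.ValiantsHypothesis.Theorems.FifoMatchingNNMonotoneHardDefs
import Summits.ValiantsHypothesis.ValiantsHypothesis.Theorems.FifoMatchingNNMonotoneHardRank
import HarnessLib

/-!
# Crux `NNMonotoneHard` (stmt-ValiantsHypothesis-11617): rank counts of the padded word `U^L v D^L`

Bookkeeping for the thick-queue measure (`Cruxes/NNMonotoneHard/PROOF-PLAN.md` §1): for
`W = padWord L N v` the numbers of openers / closers before time `t`,

* `card_filter_lt_succ_nat`, `card_filter_lt_of_le` — stepping a rank `#{i ∈ s : i < t}` in `t : ℕ`;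
* `ranks_padWord_head`, `ranks_padWord_mid`, `ranks_padWord_tail` — the two ranks of the padded
  word on the three phases: `(t, 0)` for `t ≤ L`; `(L + #{p < j : v p}, #{p < j : ¬ v p})` at
  `t = L + j`; `(L + #v⁻¹(U), #v⁻¹(D) + i)` at `t = L + N + i`;
* `card_openerSet_padWord`, `card_closerSet_padWord` — hence `#openers = L + #v⁻¹(U)`,
  `#closers = L + #v⁻¹(D)`, and the padded word is balanced iff `v` is.

Honest framing: bookkeeping only; VP ≠ VNP is not moved by anything here. No definitions, no named
facts.
-/

noncomputable section

-- Sub = Summit single-conjunct layout: the duplicated namespace component is mandated by the tree.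
set_option linter.dupNamespace false

namespace Summit.ValiantsHypothesis.ValiantsHypothesis.Theorems.FifoMatching.NNMonotoneHard

open Finset Literature.Computability.AlgebraicComplexity

/-- Stepping a rank: `#{i ∈ s : i < t+1} = #{i ∈ s : i < t} + [t ∈ s]` (the last term read as `0`
past the end of `Fin M`). [folklore] -/
theorem card_filter_lt_succ_nat {M : ℕ} (s : Finset (Fin M)) (t : ℕ) :
    (s.filter fun i => i.val < t + 1).card
      = (s.filter fun i => i.val < t).card
        + (if h : t < M then (if (⟨t, h⟩ : Fin M) ∈ s then 1 else 0) else 0) := by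
  classical
  have hsplit : (s.filter fun i => i.val < t + 1)
      = (s.filter fun i => i.val < t) ∪ (s.filter fun i => i.val = t) := by
    ext i; simp only [mem_filter, mem_union]
    constructor
    · rintro ⟨hi, hlt⟩
      by_cases h : i.val < t
      · exact Or.inl ⟨hi, h⟩
      · exact Or.inr ⟨hi, by omega⟩
    · rintro (⟨hi, h⟩ | ⟨hi, h⟩) <;> exact ⟨hi, by omega⟩
  have hdisj : Disjoint (s.filter fun i => i.val < t) (s.filter fun i => i.val = t) := by
    rw [disjoint_filter]; intro i _ h1 h2; omega
  rw [hsplit, card_union_of_disjoint hdisj]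
  congr 1
  split_ifs with h hmem
  · rw [card_eq_one]
    refine ⟨⟨t, h⟩, ?_⟩
    ext i
    simp only [mem_filter, mem_singleton]
    constructor
    · rintro ⟨-, hi⟩; exact Fin.ext hi
    · rintro rfl; exact ⟨hmem, rfl⟩
  · rw [card_eq_zero, filter_eq_empty_iff]
    intro i hi hit
    have hi' : i = ⟨t, h⟩ := Fin.ext hit
    rw [hi'] at hi
    exact hmem hi
  · rw [card_eq_zero, filter_eq_empty_iff]
    intro i _ hit
    exact h (hit ▸ i.isLt)

/-- Past the end every element is counted: `#{i ∈ s : i < t} = #s` for `M ≤ t`. [folklore] -/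
theorem card_filter_lt_of_le {M : ℕ} (s : Finset (Fin M)) {t : ℕ} (hMt : M ≤ t) :
    (s.filter fun i => i.val < t).card = s.card := by
  rw [filter_true_of_mem fun i _ => lt_of_lt_of_le i.isLt hMt]

section Pad

variable {L N : ℕ} (v : Fin N → Bool)

/-- Membership of a position in the opener set of the padded word. [folklore] -/
theorem mem_openerSet_padWord_iff (i : Fin (L + N + L)) :
    i ∈ openerSet (padWord L N v) ↔ padWord L N v i = true := mem_openerSet

/-- **Ranks of the padded word, head phase**: for `t ≤ L`, `#openers<t = t` and `#closers<t = 0`.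
[folklore] -/
theorem ranks_padWord_head {t : ℕ} (ht : t ≤ L) :
    ((openerSet (padWord L N v)).filter fun i => i.val < t).card = t ∧
      ((closerSet (padWord L N v)).filter fun i => i.val < t).card = 0 := by
  classical
  induction t with
  | zero =>
    constructor <;>
    · rw [card_eq_zero, filter_eq_empty_iff]; intro i _ h; exact Nat.not_lt_zero _ h
  | succ t ih =>
    obtain ⟨ih1, ih2⟩ := ih (by omega)
    have htM : t < L + N + L := by omega
    have hW : padWord L N v ⟨t, htM⟩ = true := padWord_apply_of_lt v (by simp; omega)
    constructor
    · rw [card_filter_lt_succ_nat, ih1, dif_pos htM, if_pos (mem_openerSet.2 hW)]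
    · rw [card_filter_lt_succ_nat, ih2, dif_pos htM, if_neg (by rw [mem_closerSet, hW]; simp)]

/-- **Ranks of the padded word, middle phase**: at time `L + j` (`j ≤ N`),
`#openers< = L + #{p < j : v p = U}` and `#closers< = #{p < j : v p = D}`. [folklore] -/
theorem ranks_padWord_mid {j : ℕ} (hj : j ≤ N) :
    ((openerSet (padWord L N v)).filter fun i => i.val < L + j).card
        = L + ((univ : Finset (Fin N)).filter fun p => p.val < j ∧ v p = true).card ∧
      ((closerSet (padWord L N v)).filter fun i => i.val < L + j).card
        = ((univ : Finset (Fin N)).filter fun p => p.val < j ∧ v p = false).card := by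
  classical
  induction j with
  | zero =>
    obtain ⟨h1, h2⟩ := ranks_padWord_head (L := L) (N := N) v (le_refl L)
    simpa using And.intro h1 h2
  | succ j ih =>
    obtain ⟨ih1, ih2⟩ := ih (by omega)
    have htM : L + j < L + N + L := by omega
    have hW : padWord L N v ⟨L + j, htM⟩ = v ⟨j, by omega⟩ :=
      padWord_apply_mid v ⟨j, by omega⟩
    have hset : ∀ (b : Bool) (j' : ℕ), ((univ : Finset (Fin N)).filter fun p => p.val < j' ∧ v p = b)
        = (univ.filter fun p => v p = b).filter (fun p => p.val < j') := by
      intro b j'; ext p; simp only [mem_filter, mem_univ, true_and]; tauto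
    have hstep : ∀ b : Bool, ((univ : Finset (Fin N)).filter fun p => p.val < j + 1 ∧ v p = b).card
        = ((univ : Finset (Fin N)).filter fun p => p.val < j ∧ v p = b).card
          + (if v ⟨j, by omega⟩ = b then 1 else 0) := by
      intro b
      rw [hset b (j + 1), hset b j, card_filter_lt_succ_nat, dif_pos (show j < N by omega)]
      simp only [mem_filter, mem_univ, true_and]
    rw [show L + (j + 1) = (L + j) + 1 by ring, card_filter_lt_succ_nat, card_filter_lt_succ_nat,
      ih1, ih2, dif_pos htM, dif_pos htM, hstep true, hstep false]
    simp only [mem_openerSet, mem_closerSet, hW]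
    constructor
    · cases v ⟨j, by omega⟩ <;> simp [Nat.add_assoc]
    · cases v ⟨j, by omega⟩ <;> simp

/-- **Ranks of the padded word, tail phase**: at time `L + N + i` (`i ≤ L`),
`#openers< = L + #v⁻¹(U)` and `#closers< = #v⁻¹(D) + i`. [folklore] -/
theorem ranks_padWord_tail {i : ℕ} (hi : i ≤ L) :
    ((openerSet (padWord L N v)).filter fun j => j.val < L + N + i).card
        = L + ((univ : Finset (Fin N)).filter fun p => v p = true).card ∧
      ((closerSet (padWord L N v)).filter fun j => j.val < L + N + i).card
        = ((univ : Finset (Fin N)).filter fun p => v p = false).card + i := by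
  classical
  induction i with
  | zero =>
    obtain ⟨h1, h2⟩ := ranks_padWord_mid (L := L) (N := N) v (le_refl N)
    have hT : ((univ : Finset (Fin N)).filter fun p => p.val < N ∧ v p = true)
        = (univ.filter fun p => v p = true) := by
      ext p; simp only [mem_filter, mem_univ, true_and, p.isLt]
    have hF : ((univ : Finset (Fin N)).filter fun p => p.val < N ∧ v p = false)
        = (univ.filter fun p => v p = false) := by
      ext p; simp only [mem_filter, mem_univ, true_and, p.isLt]
    rw [hT] at h1; rw [hF] at h2
    simp only [Nat.add_zero]
    exact ⟨h1, h2⟩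
  | succ i ih =>
    obtain ⟨ih1, ih2⟩ := ih (by omega)
    have htM : L + N + i < L + N + L := by omega
    have hW : padWord L N v ⟨L + N + i, htM⟩ = false := padWord_apply_of_ge v (by simp)
    rw [show L + N + (i + 1) = (L + N + i) + 1 by ring, card_filter_lt_succ_nat,
      card_filter_lt_succ_nat, ih1, ih2, dif_pos htM, dif_pos htM]
    simp only [mem_openerSet, mem_closerSet, hW]
    simp
    ring

/-- `#openers (U^L v D^L) = L + #v⁻¹(U)`. [folklore] -/
theorem card_openerSet_padWord :
    (openerSet (padWord L N v)).card = L + ((univ : Finset (Fin N)).filter fun p => v p = true).card := by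
  rw [← card_filter_lt_of_le (openerSet (padWord L N v)) (le_refl (L + N + L))]
  exact (ranks_padWord_tail v (le_refl L)).1

/-- `#closers (U^L v D^L) = L + #v⁻¹(D)`. [folklore] -/
theorem card_closerSet_padWord :
    (closerSet (padWord L N v)).card = ((univ : Finset (Fin N)).filter fun p => v p = false).card + L := by
  rw [← card_filter_lt_of_le (closerSet (padWord L N v)) (le_refl (L + N + L))]
  exact (ranks_padWord_tail v (le_refl L)).2

/-- The numbers of `U`- and `D`-letters of `v` add up to `N`. [folklore] -/
theorem card_true_add_card_false :
    ((univ : Finset (Fin N)).filter fun p => v p = true).card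
      + ((univ : Finset (Fin N)).filter fun p => v p = false).card = N := by
  classical
  have := card_filter_add_card_filter_not (s := (univ : Finset (Fin N))) (fun p => v p = true)
  simp only [card_univ, Fintype.card_fin, Bool.not_eq_true] at this
  exact this

/-- **The padded word is balanced iff `v` is**: if `v` has as many `U`s as `D`s then
`#closers (U^L v D^L) = #openers (U^L v D^L)`. [folklore] -/
theorem balanced_padWord (hv : 2 * ((univ : Finset (Fin N)).filter fun p => v p = true).card = N) :
    (closerSet (padWord L N v)).card = (openerSet (padWord L N v)).card := by
  rw [card_openerSet_padWord, card_closerSet_padWord]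
  have := card_true_add_card_false v
  omega

end Pad

end Summit.ValiantsHypothesis.ValiantsHypothesis.Theorems.FifoMatching.NNMonotoneHard
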